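import Summits.Ventures.PercRepro.Induction
import Summits.Ventures.PercRepro.Graph

/-!
# Single-merge concavity for three marked vertices

For Bernoulli bond percolation on a finite multigraph `G` with edge probabilities `p` and three
marked vertices `a, b, c`, the partition law is the vector `π = (x, y₁, y₂, y₃, z)` of the
probabilities of the five partition events `G.triEvent a b c`:
`x = P(a~b ∧ b~c)` (partition `abc`), `y₁ = P(a~b ∧ b≁c)` (`ab|c`), `y₂ = P(a~c ∧ a≁b)` (`ac|b`),
`y₃ = P(b~c ∧ a≁b)` (`bc|a`), `z = P(a≁b ∧ b≁c ∧ a≁c)` (`a|b|c`).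

**Single-merge concavity** (`quad_nonneg_of_moves`): let `A` be a real `5 × 5` matrix with
nonnegative diagonal whose bilinear form is `≤ 0` on every pair of *move vectors*.  Then the
quadratic form `∑ i j, A i j π i π j` is nonnegative for every `G`, `p ∈ [0, 1]^E`, `a`, `b`, `c`.

Proof.  Induct on the free edges (`induction_free`, `Summits.Ventures.PercRepro.Induction`).  Conditioning on one edge `e`
(`prob_split`) makes `π` affine in `t = p e`: `π = (1 - t) π⁰ + t π¹`, hence the chord identity
`Q(π) = (1 - t) Q(π⁰) + t Q(π¹) - t (1 - t) Q(π¹ - π⁰)` (`bilin_affine`).  The increment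
`π¹ - π⁰` is a nonnegative combination, over the configurations `ω` with `e` closed, of the
vectors `d(ω) = 1(ω[e := open]) - 1(ω)` (`prob_update_one_sub_prob_update_zero_eq_sum`), and opening
one edge merges at most two open clusters (`conn_update_true_iff`), so each `d(ω)` is one of the
seven move vectors (`Move`, `exists_move`): the identity, `a|b|c → ab|c`, `a|b|c → ac|b`,
`a|b|c → bc|a`, `ab|c → abc`, `ac|b → abc`, `bc|a → abc`.  Hence `Q(π¹ - π⁰) ≤ 0`
(`bilin_sum_sum_nonpos`), and the two chord terms are nonnegative by induction.  In the base
case a point mass realises a single partition, so `Q(π) = A k k ≥ 0`.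

Neither Harris/FKG nor BK/Reimer enters.  The pair-sum inequality is the instance in
`Summits.Ventures.PercRepro.PairSum`.
-/

namespace PercRepro

open Finset

variable {E : Type*} [Fintype E] [DecidableEq E]

/-! ### Bilinear forms on finite index sets -/

section Bilin

variable {ι κ : Type*} [Fintype ι] [Fintype κ]

/-- The bilinear form `bilin A x y = ∑ i, ∑ j, A i j * x i * y j`. -/
def bilin (A : ι → ι → ℝ) (x y : ι → ℝ) : ℝ := ∑ i, ∑ j, A i j * x i * y j

/-- **Chord identity** for the quadratic form along a segment:
`Q((1 - t) u + t v) = (1 - t) Q(u) + t Q(v) - t (1 - t) Q(v - u)`. -/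
theorem bilin_affine (A : ι → ι → ℝ) (u v : ι → ℝ) (t : ℝ) :
    bilin A (fun i => (1 - t) * u i + t * v i) (fun i => (1 - t) * u i + t * v i) =
      (1 - t) * bilin A u u + t * bilin A v v -
        t * (1 - t) * bilin A (fun i => v i - u i) (fun i => v i - u i) := by
  unfold bilin
  simp only [Finset.mul_sum, ← Finset.sum_add_distrib, ← Finset.sum_sub_distrib]
  refine Finset.sum_congr rfl fun i _ => Finset.sum_congr rfl fun j _ => ?_
  ring

/-- Linearity of `bilin` in the first argument, for a finite combination of vectors. -/
theorem bilin_sum_left (A : ι → ι → ℝ) (c : κ → ℝ) (d : κ → ι → ℝ) (y : ι → ℝ) :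
    bilin A (fun i => ∑ ω, c ω * d ω i) y = ∑ ω, c ω * bilin A (d ω) y := by
  unfold bilin
  simp only [Finset.mul_sum, Finset.sum_mul]
  calc ∑ i, ∑ j, ∑ ω, A i j * (c ω * d ω i) * y j
      = ∑ i, ∑ ω, ∑ j, A i j * (c ω * d ω i) * y j :=
        Finset.sum_congr rfl fun i _ => Finset.sum_comm
    _ = ∑ ω, ∑ i, ∑ j, A i j * (c ω * d ω i) * y j := Finset.sum_comm
    _ = ∑ ω, ∑ i, ∑ j, c ω * (A i j * d ω i * y j) :=
        Finset.sum_congr rfl fun ω _ => Finset.sum_congr rfl fun i _ =>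
          Finset.sum_congr rfl fun j _ => by ring

/-- Linearity of `bilin` in the second argument, for a finite combination of vectors. -/
theorem bilin_sum_right (A : ι → ι → ℝ) (x : ι → ℝ) (c : κ → ℝ) (d : κ → ι → ℝ) :
    bilin A x (fun j => ∑ ω, c ω * d ω j) = ∑ ω, c ω * bilin A x (d ω) := by
  unfold bilin
  simp only [Finset.mul_sum]
  calc ∑ i, ∑ j, ∑ ω, A i j * x i * (c ω * d ω j)
      = ∑ i, ∑ ω, ∑ j, A i j * x i * (c ω * d ω j) :=
        Finset.sum_congr rfl fun i _ => Finset.sum_comm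
    _ = ∑ ω, ∑ i, ∑ j, A i j * x i * (c ω * d ω j) := Finset.sum_comm
    _ = ∑ ω, ∑ i, ∑ j, c ω * (A i j * x i * d ω j) :=
        Finset.sum_congr rfl fun ω _ => Finset.sum_congr rfl fun i _ =>
          Finset.sum_congr rfl fun j _ => by ring

/-- If the bilinear form is `≤ 0` on all pairs of vectors `d ω`, `d ω'` with nonzero
coefficients, then the quadratic form of a nonnegative combination of the `d ω` is `≤ 0`. -/
theorem bilin_sum_sum_nonpos (A : ι → ι → ℝ) (c : κ → ℝ) (hc : ∀ ω, 0 ≤ c ω) (d : κ → ι → ℝ)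
    (hd : ∀ ω ω', c ω ≠ 0 → c ω' ≠ 0 → bilin A (d ω) (d ω') ≤ 0) :
    bilin A (fun i => ∑ ω, c ω * d ω i) (fun i => ∑ ω, c ω * d ω i) ≤ 0 := by
  rw [bilin_sum_left]
  refine Finset.sum_nonpos fun ω _ => ?_
  by_cases h : c ω = 0
  · simp [h]
  rw [bilin_sum_right]
  refine mul_nonpos_of_nonneg_of_nonpos (hc ω) (Finset.sum_nonpos fun ω' _ => ?_)
  by_cases h' : c ω' = 0
  · simp [h']
  exact mul_nonpos_of_nonneg_of_nonpos (hc ω') (hd ω ω' h h')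

/-- The quadratic form of a unit vector is the corresponding diagonal entry. -/
theorem bilin_single [DecidableEq ι] (A : ι → ι → ℝ) (k : ι) :
    bilin A (fun i => if i = k then 1 else 0) (fun i => if i = k then 1 else 0) = A k k := by
  unfold bilin
  simp [Finset.sum_ite_eq', mul_ite]

end Bilin

/-! ### The increment of the law when one edge is freed -/

/-- `P_{p[e:=1]}(A) - P_{p[e:=0]}(A)` as a nonnegative combination, over the configurations `ω`
with `e` closed, of the indicator increments `1_A(ω[e := open]) - 1_A(ω)`. -/
theorem prob_update_one_sub_prob_update_zero_eq_sum (p : E → ℝ) (e : E) (A : Set (Config E)) :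
    prob (Function.update p e 1) A - prob (Function.update p e 0) A =
      ∑ ω, (if ω e = false then weightErase p e ω else 0) *
        (A.indicator 1 (Function.update ω e true) - A.indicator 1 ω) := by
  unfold prob
  simp only [indicator_weight_update_one, indicator_weight_update_zero]
  rw [← (flipEdge_involutive e).bijective.sum_comp
    (fun ω => (A ∩ {ω | ω e = true}).indicator (weightErase p e) ω), ← Finset.sum_sub_distrib]
  refine Finset.sum_congr rfl fun ω _ => ?_
  cases h : ω e
  · -- `e` is closed in `ω`: `flipEdge e ω` is `ω` with `e` opened
    have hflip : flipEdge e ω = Function.update ω e true := by simp [flipEdge, h]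
    have hw : weightErase p e (Function.update ω e true) = weightErase p e ω := by
      rw [← hflip]
      exact weightErase_flipEdge p e ω
    by_cases hA : ω ∈ A <;> by_cases hA' : Function.update ω e true ∈ A <;>
      simp [Set.indicator, hA, hA', h, hflip, hw]
  · -- `e` is open in `ω`: both sides vanish
    by_cases hA : ω ∈ A <;> by_cases hA' : flipEdge e ω ∈ A <;>
      simp [Set.indicator, hA, hA', h]

namespace MultiGraph

variable {V : Type*} (G : MultiGraph V E)

/-! ### The five partition events of three marked vertices -/

/-- The five partition events of the marked vertices `a, b, c`, indexed as the engine's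
variables: `0 ↦ x = {a ~ b ∧ b ~ c}` (partition `abc`), `1 ↦ y₁ = {a ~ b ∧ b ≁ c}` (`ab | c`),
`2 ↦ y₂ = {a ~ c ∧ a ≁ b}` (`ac | b`), `3 ↦ y₃ = {b ~ c ∧ a ≁ b}` (`bc | a`),
`4 ↦ z = {a ≁ b ∧ b ≁ c ∧ a ≁ c}` (`a | b | c`). -/
def triEvent (a b c : V) : Fin 5 → Set (Config E) :=
  ![G.connEvent a b ∩ G.connEvent b c,
    G.connEvent a b ∩ G.sepEvent b c,
    G.connEvent a c ∩ G.sepEvent a b,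
    G.connEvent b c ∩ G.sepEvent a b,
    G.sepEvent a b ∩ G.sepEvent b c ∩ G.sepEvent a c]

/-- The partition law of three marked vertices as a vector: `triLaw p a b c i = P_p(triEvent i)`. -/
noncomputable def triLaw (p : E → ℝ) (a b c : V) : Fin 5 → ℝ :=
  fun i => prob p (G.triEvent a b c i)

/-- The indicator vector of the five partition events as a function of the three connection
atoms `ab = [a ~ b]`, `bc = [b ~ c]`, `ac = [a ~ c]`. -/
def atomVec (ab bc ac : Bool) : Fin 5 → ℤ :=
  ![if ab && bc then 1 else 0, if ab && !bc then 1 else 0, if ac && !ab then 1 else 0,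
    if bc && !ab then 1 else 0, if !ab && !bc && !ac then 1 else 0]

omit [Fintype E] [DecidableEq E] in
open Classical in
/-- The indicator of the `i`-th partition event is the `i`-th entry of `atomVec`. -/
theorem indicator_triEvent (a b c : V) (ω : Config E) (i : Fin 5) :
    (G.triEvent a b c i).indicator 1 ω =
      ((atomVec (decide (G.Conn ω a b)) (decide (G.Conn ω b c)) (decide (G.Conn ω a c)) i : ℤ) :
        ℝ) := by
  fin_cases i <;> by_cases hab : G.Conn ω a b <;> by_cases hbc : G.Conn ω b c <;>
    by_cases hac : G.Conn ω a c <;> simp [triEvent, atomVec, hab, hbc, hac, Set.indicator]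

/-- For consistent atoms (connectivity is transitive) the indicator vector is a unit vector. -/
theorem atomVec_eq_single (ab bc ac : Bool) (t1 : ab = true → bc = true → ac = true)
    (t2 : ab = true → ac = true → bc = true) (t3 : bc = true → ac = true → ab = true) :
    ∃ k : Fin 5, ∀ i, atomVec ab bc ac i = if i = k then 1 else 0 := by
  revert ab bc ac
  decide

/-! ### Moves: how the partition changes when one edge is opened -/

/-- The seven possible changes of the partition of three marked vertices when a single edge is
opened: nothing, `a|b|c → ab|c`, `a|b|c → ac|b`, `a|b|c → bc|a`, `ab|c → abc`, `ac|b → abc`,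
`bc|a → abc`. -/
inductive Move
  | stay | bToP1 | bToP2 | bToP3 | p1ToT | p2ToT | p3ToT
  deriving DecidableEq, Fintype

/-- The change of the indicator vector along a move (integer entries). -/
def Move.ivec : Move → Fin 5 → ℤ
  | .stay => ![0, 0, 0, 0, 0]
  | .bToP1 => ![0, 1, 0, 0, -1]
  | .bToP2 => ![0, 0, 1, 0, -1]
  | .bToP3 => ![0, 0, 0, 1, -1]
  | .p1ToT => ![1, -1, 0, 0, 0]
  | .p2ToT => ![1, 0, -1, 0, 0]
  | .p3ToT => ![1, 0, 0, -1, 0]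

/-- The change of the indicator vector along a move (real entries). -/
def Move.vec (mv : Move) : Fin 5 → ℝ := fun i => (mv.ivec i : ℝ)

/-- The combinatorial core: if the atoms `(ab₀, bc₀, ac₀)` of a configuration and the atoms
`(ab₁, bc₁, ac₁)` after opening one edge are consistent (transitivity), monotone, and the edge
does not join all three vertices at once (`a|b|c ↛ abc`), then the increment of the indicator
vector is a move vector. -/
theorem atomVec_sub_eq_move (ab0 bc0 ac0 ab1 bc1 ac1 : Bool)
    (m1 : ab0 = true → ab1 = true) (m2 : bc0 = true → bc1 = true) (m3 : ac0 = true → ac1 = true)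
    (t1 : ab0 = true → bc0 = true → ac0 = true) (t2 : ab0 = true → ac0 = true → bc0 = true)
    (t3 : bc0 = true → ac0 = true → ab0 = true)
    (s1 : ab1 = true → bc1 = true → ac1 = true) (s2 : ab1 = true → ac1 = true → bc1 = true)
    (s3 : bc1 = true → ac1 = true → ab1 = true)
    (hBT : ab0 = false → bc0 = false → ac0 = false → ab1 = true → bc1 = true → False) :
    ∃ mv : Move, ∀ i, atomVec ab1 bc1 ac1 i - atomVec ab0 bc0 ac0 i = mv.ivec i := by
  cases ab0 <;> cases bc0 <;> cases ac0 <;> cases ab1 <;> cases bc1 <;> cases ac1 <;>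
    simp at * <;> decide

omit [Fintype E] in
/-- Opening one edge cannot join three pairwise separated vertices: a single edge merges at
most two open clusters. -/
theorem not_conn_conn_update_of_sep {ω : Config E} {e : E} {a b c : V}
    (hab : ¬ G.Conn ω a b) (hbc : ¬ G.Conn ω b c) (hac : ¬ G.Conn ω a c)
    (hab' : G.Conn (Function.update ω e true) a b)
    (hbc' : G.Conn (Function.update ω e true) b c) : False := by
  rw [conn_update_true_iff] at hab' hbc'
  rcases hab' with h | ⟨h1, h2⟩ | ⟨h1, h2⟩
  · exact hab h
  · rcases hbc' with h | ⟨h3, h4⟩ | ⟨h3, h4⟩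
    · exact hbc h
    · exact hab (h1.trans h3.symm)
    · exact hac (h1.trans h4)
  · rcases hbc' with h | ⟨h3, h4⟩ | ⟨h3, h4⟩
    · exact hbc h
    · exact hac (h1.trans h4)
    · exact hab (h1.trans h3.symm)

omit [Fintype E] in
open Classical in
/-- **Single merge**: the increment of the indicator vector of the five partition events when
the edge `e` is opened in the configuration `ω` is a move vector. -/
theorem exists_move (a b c : V) (ω : Config E) (e : E) :
    ∃ mv : Move, ∀ i, (G.triEvent a b c i).indicator 1 (Function.update ω e true) -
      (G.triEvent a b c i).indicator 1 ω = mv.vec i := by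
  set ω' := Function.update ω e true with hω'
  have mono : ∀ u v, G.Conn ω u v → G.Conn ω' u v := fun u v h => h.update_true
  obtain ⟨mv, hmv⟩ := atomVec_sub_eq_move (decide (G.Conn ω a b)) (decide (G.Conn ω b c))
    (decide (G.Conn ω a c)) (decide (G.Conn ω' a b)) (decide (G.Conn ω' b c))
    (decide (G.Conn ω' a c))
    (by simpa using mono a b) (by simpa using mono b c) (by simpa using mono a c)
    (by simpa using fun h1 h2 => Conn.trans (G := G) h1 h2)
    (by simpa using fun h1 h2 => Conn.trans (G := G) h1.symm h2)
    (by simpa using fun h1 h2 => Conn.trans (G := G) h2 h1.symm)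
    (by simpa using fun h1 h2 => Conn.trans (G := G) h1 h2)
    (by simpa using fun h1 h2 => Conn.trans (G := G) h1.symm h2)
    (by simpa using fun h1 h2 => Conn.trans (G := G) h2 h1.symm)
    (by simpa using fun h1 h2 h3 h4 h5 => G.not_conn_conn_update_of_sep h1 h2 h3 h4 h5)
  refine ⟨mv, fun i => ?_⟩
  rw [indicator_triEvent, indicator_triEvent, Move.vec, ← hmv i]
  push_cast
  ring

/-! ### The single-merge concavity theorem -/

/-- **Single-merge concavity** for three marked vertices.  Let `A` be a `5 × 5` real matrix
indexed by the partitions `abc, ab|c, ac|b, bc|a, a|b|c` with nonnegative diagonal and with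
`bilin A d d' ≤ 0` for all pairs of move vectors.  Then the quadratic form
`∑ i j, A i j π i π j` of the partition law `π = (x, y₁, y₂, y₃, z)` is nonnegative for every
finite multigraph, every edge-probability vector and every three vertices. -/
theorem quad_nonneg_of_moves (A : Fin 5 → Fin 5 → ℝ) (hdiag : ∀ i, 0 ≤ A i i)
    (hmove : ∀ mv mv' : Move, bilin A mv.vec mv'.vec ≤ 0) (p : E → ℝ) (hp : IsProb p)
    (a b c : V) : 0 ≤ bilin A (G.triLaw p a b c) (G.triLaw p a b c) := by
  classical
  refine induction_free (P := fun p => 0 ≤ bilin A (G.triLaw p a b c) (G.triLaw p a b c))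
    ?_ ?_ hp
  · -- base case: a point mass realises exactly one partition
    intro σ
    have hlaw : G.triLaw (detWeights σ) a b c = fun i =>
        ((atomVec (decide (G.Conn σ a b)) (decide (G.Conn σ b c)) (decide (G.Conn σ a c)) i :
          ℤ) : ℝ) := by
      funext i
      rw [triLaw, prob_detWeights, indicator_triEvent]
    obtain ⟨k, hk⟩ := atomVec_eq_single (decide (G.Conn σ a b)) (decide (G.Conn σ b c))
      (decide (G.Conn σ a c))
      (by simpa using fun h1 h2 => Conn.trans (G := G) h1 h2)
      (by simpa using fun h1 h2 => Conn.trans (G := G) h1.symm h2)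
      (by simpa using fun h1 h2 => Conn.trans (G := G) h2 h1.symm)
    have hlaw' : G.triLaw (detWeights σ) a b c = fun i => if i = k then 1 else 0 := by
      rw [hlaw]
      funext i
      rw [hk i]
      split_ifs <;> simp
    rw [hlaw', bilin_single]
    exact hdiag k
  · -- inductive step: the chord identity along the edge `e`
    intro p e hp h1 h0
    have hsplit : G.triLaw p a b c = fun i =>
        (1 - p e) * G.triLaw (Function.update p e 0) a b c i +
          p e * G.triLaw (Function.update p e 1) a b c i := by
      funext i
      simp only [triLaw]
      rw [prob_split p e]
      ring
    rw [hsplit, bilin_affine]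
    have hdiff : (fun i => G.triLaw (Function.update p e 1) a b c i -
        G.triLaw (Function.update p e 0) a b c i) =
        fun i => ∑ ω, (if ω e = false then weightErase p e ω else 0) *
          ((G.triEvent a b c i).indicator 1 (Function.update ω e true) -
            (G.triEvent a b c i).indicator 1 ω) := by
      funext i
      simp only [triLaw]
      exact prob_update_one_sub_prob_update_zero_eq_sum p e _
    have hneg : bilin A (fun i => G.triLaw (Function.update p e 1) a b c i -
        G.triLaw (Function.update p e 0) a b c i)
        (fun i => G.triLaw (Function.update p e 1) a b c i -
          G.triLaw (Function.update p e 0) a b c i) ≤ 0 := by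
      rw [hdiff]
      refine bilin_sum_sum_nonpos A _ (fun ω => ?_) _ (fun ω ω' _ _ => ?_)
      · split_ifs
        · exact weightErase_nonneg hp e ω
        · exact le_rfl
      · obtain ⟨mv, hmv⟩ := G.exists_move a b c ω e
        obtain ⟨mv', hmv'⟩ := G.exists_move a b c ω' e
        have h1 : (fun i => (G.triEvent a b c i).indicator 1 (Function.update ω e true) -
            (G.triEvent a b c i).indicator 1 ω) = mv.vec := funext hmv
        have h2 : (fun i => (G.triEvent a b c i).indicator 1 (Function.update ω' e true) -
            (G.triEvent a b c i).indicator 1 ω') = mv'.vec := funext hmv'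
        rw [h1, h2]
        exact hmove mv mv'
    have ht0 := hp.nonneg e
    have ht1 := hp.one_sub_nonneg e
    nlinarith [mul_nonneg ht0 ht1, mul_nonneg ht1 h0, mul_nonneg ht0 h1,
      mul_nonneg (mul_nonneg ht0 ht1) (neg_nonneg.2 hneg)]

end MultiGraph

end PercRepro
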